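import Literature.NumberTheory.Transcendental.KZCubicalCalculus
import Literature.NumberTheory.Transcendental.CalegariDimitrovTangL2Chi3Period
import Mathlib.MeasureTheory.Integral.Pi
import Mathlib.MeasureTheory.Integral.DominatedConvergence
import Mathlib.Analysis.SpecificLimits.Basic
import Mathlib.Analysis.SpecialFunctions.Integrals.Basic

/-!
# `ReductionRigidity` (stmt-KontsevichZagierPeriods-3407), line `Sketch` (growth programme
# `DilogRigidity`): stub `stub_cubeTwoIntegralSeries`

THE VALUE OF THE WEIGHT-TWO NORMAL FORM AS A SERIES. For an integer `N ≥ 2`,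

  `L₂ = ∫_{[0,1]²} dx dy / (N − x y) = ∑_{k ≥ 0} N^{-(k+1)} / (k+1)² = Li₂(1/N)`.

This is the bridge identifying the `(2, 1/N)` Padé box integral with the dilogarithm series used by
the lead's `ℚ`-linear independence argument for `1, L₁, L₂`.

Proof (termwise integration of the geometric expansion):
* on the cube `u = x y ∈ [0, 1]` and `N ≥ 2`, so `0 ≤ u/N < 1` and
  `1/(N − u) = (1/N) · 1/(1 − u/N) = ∑_k (1/N)^{k+1} u^k` (`hasSum_geometric_of_lt_one`);
* `∫` and `∑` are swapped by `MeasureTheory.integral_tsum_of_summable_integral_norm`: each term is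
  continuous on the compact cube, nonnegative there, and its integral is `(1/N)^{k+1}/(k+1)²`, a
  summable sequence (dominated by the geometric series `∑ (1/N)^{k+1}`);
* termwise, `∫_{[0,1]²} (x y)^k = (∫₀¹ x^k)² = 1/(k+1)²` by Fubini on `Fin 2 → ℝ`
  (`Measure.restrict_pi_pi`, `integral_fintype_prod_eq_pow`) and the tree's
  `CalegariDimitrovTang.setIntegral_Icc_pow` (`CalegariDimitrovTangL2Chi3Period.lean`, which runs
  the same termwise integration on `ℝ × ℝ` for the kernel `1/(1 + st + s²t²)`).
-/

noncomputable section

open MeasureTheory Set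

namespace Summit.KontsevichZagierPeriods.HermiteRigidity.ReductionRigidity

open Literature.NumberTheory.Transcendental
open Literature.NumberTheory.Transcendental.KZ

/-! ## Termwise integrals `∫_{[0,1]²} (x y)^k dx dy = 1/(k+1)²` -/

/-- Fubini on the square: `∫_{[0,1]²} (x y)^k dx dy = (∫₀¹ x^k dx)² = 1/(k+1)²` (the one-variable
moment `∫₀¹ x^k dx = 1/(k+1)` is the tree's `CalegariDimitrovTang.setIntegral_Icc_pow`).
[folklore] -/
theorem integral_cube_two_mul_pow (k : ℕ) :
    ∫ p in cube 2, (p 0 * p 1) ^ k = 1 / ((k : ℝ) + 1) ^ 2 := by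
  have h1 : ∀ p : Fin 2 → ℝ, (p 0 * p 1) ^ k = ∏ i : Fin 2, (p i) ^ k := by
    intro p; rw [Fin.prod_univ_two, mul_pow]
  simp_rw [h1]
  rw [cube_eq_pi, volume_pi, Measure.restrict_pi_pi]
  have h := integral_fintype_prod_eq_pow (ι := Fin 2) (fun x : ℝ => x ^ k)
    (μ := volume.restrict (Icc (0 : ℝ) 1))
  rw [Fintype.card_fin] at h
  rw [h, CalegariDimitrovTang.setIntegral_Icc_pow, one_div_pow]

/-! ## The series `∫_{[0,1]²} dx dy/(N − x y) = ∑_k N^{-(k+1)}/(k+1)²` -/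

/-- **The weight-two normal form as a dilogarithm series**: for an integer `N ≥ 2`,
`∫_{[0,1]²} dx dy/(N − x y) = ∑_{k ≥ 0} (1/N)^{k+1}/(k+1)² (= Li₂(1/N))`, by termwise integration
of the geometric expansion `1/(N − x y) = ∑_k (x y)^k/N^{k+1}` (absolutely convergent on the closed
square since `0 ≤ x y/N ≤ 1/2`). [cite: KontsevichZagier2001, §1.1] -/
theorem stub_cubeTwoIntegralSeries : ∀ (N : ℕ), 2 ≤ N →
    ∫ p in cube 2, 1 / ((N : ℝ) - p 0 * p 1) =
      ∑' k : ℕ, (1 / (N : ℝ)) ^ (k + 1) / ((k : ℝ) + 1) ^ 2 := by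
  intro N hN
  have hN' : (2 : ℝ) ≤ (N : ℝ) := by exact_mod_cast hN
  have hNpos : (0 : ℝ) < (N : ℝ) := by linarith
  -- the terms of the expansion
  set F : ℕ → (Fin 2 → ℝ) → ℝ := fun k p => (1 / (N : ℝ)) ^ (k + 1) * (p 0 * p 1) ^ k with hF
  -- bounds on `u = x y` on the cube
  have hu : ∀ p ∈ cube 2, 0 ≤ p 0 * p 1 ∧ p 0 * p 1 ≤ 1 := fun p hp =>
    ⟨mul_nonneg (hp 0).1 (hp 1).1, mul_le_one₀ (hp 0).2 (hp 1).1 (hp 1).2⟩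
  -- pointwise geometric expansion on the cube
  have hexp : EqOn (fun p : Fin 2 → ℝ => 1 / ((N : ℝ) - p 0 * p 1)) (fun p => ∑' k, F k p)
      (cube 2) := by
    intro p hp
    obtain ⟨h0, h1⟩ := hu p hp
    have hr0 : 0 ≤ p 0 * p 1 / (N : ℝ) := div_nonneg h0 hNpos.le
    have hr1 : p 0 * p 1 / (N : ℝ) < 1 := by
      rw [div_lt_one hNpos]; linarith
    have hgeom := (hasSum_geometric_of_lt_one hr0 hr1).mul_left (1 / (N : ℝ))
    have hval : 1 / (N : ℝ) * (1 - p 0 * p 1 / (N : ℝ))⁻¹ = 1 / ((N : ℝ) - p 0 * p 1) := by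
      have hne : (N : ℝ) - p 0 * p 1 ≠ 0 := by linarith
      field_simp
    have hterm : (fun k : ℕ => 1 / (N : ℝ) * (p 0 * p 1 / (N : ℝ)) ^ k) = fun k => F k p := by
      funext k
      simp only [hF]
      ring
    rw [hval, hterm] at hgeom
    exact hgeom.tsum_eq.symm
  -- each term is integrable on the cube
  have hint : ∀ k, Integrable (F k) (volume.restrict (cube 2)) := by
    intro k
    have hc : Continuous (F k) := by
      simp only [hF]
      fun_prop
    exact hc.continuousOn.integrableOn_compact isCompact_cube
  -- the value of each termwise integral
  have hval : ∀ k, ∫ p in cube 2, F k p = (1 / (N : ℝ)) ^ (k + 1) / ((k : ℝ) + 1) ^ 2 := by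
    intro k
    simp only [hF]
    rw [integral_const_mul, integral_cube_two_mul_pow, mul_one_div]
  -- the norms: `‖F k p‖ = F k p` on the cube
  have hnorm : ∀ k, ∫ p in cube 2, ‖F k p‖ = (1 / (N : ℝ)) ^ (k + 1) / ((k : ℝ) + 1) ^ 2 := by
    intro k
    rw [← hval k]
    refine setIntegral_congr_fun measurableSet_cube fun p hp => ?_
    simp only [hF]
    exact Real.norm_of_nonneg (mul_nonneg (pow_nonneg (by positivity) _) (pow_nonneg (hu p hp).1 _))
  -- summability of the norms: dominated by the geometric series `∑ (1/N)^(k+1)`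
  have hsum : Summable fun k => ∫ p in cube 2, ‖F k p‖ := by
    simp_rw [hnorm]
    have hq0 : 0 ≤ 1 / (N : ℝ) := by positivity
    have hq1 : 1 / (N : ℝ) < 1 := by rw [div_lt_one hNpos]; linarith
    have hg : Summable fun k : ℕ => 1 / (N : ℝ) * (1 / (N : ℝ)) ^ k :=
      (summable_geometric_of_lt_one hq0 hq1).mul_left _
    refine Summable.of_nonneg_of_le (fun k => by positivity) (fun k => ?_) hg
    rw [← pow_succ', div_le_iff₀ (by positivity)]
    have hk : (1 : ℝ) ≤ ((k : ℝ) + 1) ^ 2 := by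
      nlinarith [(k.cast_nonneg : (0 : ℝ) ≤ k)]
    nlinarith [pow_nonneg hq0 (k + 1)]
  -- termwise integration
  rw [setIntegral_congr_fun measurableSet_cube hexp,
    ← integral_tsum_of_summable_integral_norm hint hsum]
  exact tsum_congr hval

end Summit.KontsevichZagierPeriods.HermiteRigidity.ReductionRigidity
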